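/-
Copyright: lit-balaban cell (HOME `run/shared/lean/pub/lit-balaban/`), Phase-2 proof seat p12 (gen 11).  The proofs are
kernel-checked; nothing is claimed beyond what the kernel checks below.
-/
import Literature.MathematicalPhysics.QuantumFieldTheory.DybalskiStottmeisterTanimoto2024.DST24MethodOfImages

/-!
# `DybalskiStottmeisterTanimoto2024.DST24NeumannBoundary` — [DybalskiStottmeisterTanimoto2024] §4.4 **Definition (Neumann) and Lemma
# (De-vs-De-Om): PROVED for `ℓ = 1`, REFUTED AS PRINTED for `ℓ = 2`, PROVED for all `ℓ` in the image-symmetric form the method of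
# images uses; Lemma (projection-lemma-2d)** — `((−Δ_Ω + Q*Q)^ℓ v_Ω)(x) = ((−Δ + Q*Q)^ℓ v)(x)` (`x ∈ Ω`) holds for every `v` with Neumann
# boundary values when `ℓ = 1`, needs more than the boundary relations when `ℓ = 2`, and holds for all `ℓ` when `v = w ∘ fold`

statement-level skeleton of published theorems with citation tags; proofs where landed; nothing here is a claim about
the Yang–Mills mass gap

W. Dybalski, A. Stottmeister, Y. Tanimoto, *The Bałaban variational problem in the non-linear sigma model*, Rev. Math. Phys.
**36** (2024), arXiv:2403.09800; source held `paper:arxiv-2403.09800` (§4.4 = tex chunks p0013–p0014).  Unit `lit-balaban-p12`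
(gen 11).  Vocabulary: `DST24GreenDecayLattice` (`MK d L` = kernel of `M = −Δ + Q*Q` on `ℤ^d`, `e`, `blkZ`, `boxZ`),
`DST24MethodOfImages` (`MΩ d L n hn` = kernel of `−Δ_Ω + Q*Q` with Neumann boundary conditions on `Ω = [0,n)^d`, `fold`, `lift`,
`MΩ_apply`, `fold_lift_add_e`, `fold_lift_sub_e`, `blkΩ`, `boxΩ`, `sum_boxΩ_eq_sum_boxZ`).

WHAT IS PRINTED (§4.4, chunk p0013 L118–126 and p0014 L15–31, verbatim).  «**Definition.** We say that a function `v ∈ 𝓛²(ℤ^d)`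
satisfies Neumann boundary conditions on `Ω`, if the following relations hold on the respective subsets of the boundary:
`(∂*_μ v)(x) = 0` for `x ∈ ∂Ω_μ`, `(∂_μ v)(x) = 0` for `x ∈ ∂Ω^μ`, `μ = 0,1`. We denote the subspace of such functions `D_Ω`.»
(with `(∂_μ f)(x) := f(x+e_μ) − f(x)`, `(∂*_μ f)(x) := −(f(x) − f(x−e_μ))`, `∂Ω_μ = {x_μ = 0}`, `∂Ω^μ = {x_μ = n−1}`).  «**Lemma
(De-vs-De-Om).** Suppose that `v ∈ D_Ω`. Then, for any `ℓ ∈ ℕ` we have `((−Δ_Ω + Q*Q)^ℓ v_Ω)(x) = ((−Δ + Q*Q)^ℓ v)(x)`, where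
`x ∈ Ω` and `v_Ω := v|_Ω`. *Proof.* Property (Neumann-free) clearly holds for `ℓ = 1` by definition of `D_Ω`. … Now we obtain from
Lemmas (projection-lemma-2d), (Q-reflection) that if `f ∈ D_Ω` then also `(−Δ + Q*Q)v ∈ D_Ω`. Thus we can iterate the argument …»

WHAT IS PROVED HERE (every `d ≥ 1`, `Ω = [0,Ln₁)^d`, `L, n₁ ≥ 1`; the paper's `d = 2`).
* `NeumannBC n v` — Definition (Neumann), typed on functions `v : ℤ^d → ℝ` (no `𝓛²` condition is needed for the identities, all
  sums being finite: `M` has finite range).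
* THE BOUNDARY DEFECT (`MΩ_sub_MK_apply`): for EVERY `w : ℤ^d → ℝ` and `x ∈ Ω`,
  `((−Δ_Ω + Q*Q) w_Ω)(x) − ((−Δ + Q*Q) w)(x) = Σ_μ ([x_μ = n−1](w(x+e_μ) − w(x)) + [x_μ = 0](w(x−e_μ) − w(x)))` — the dropped Neumann
  bonds (`MΩ_apply` against the row action `tsum_MK_mul` of `M`; the `Q*Q` parts agree because the blocks of `Ω` are blocks of `ℤ^d`).
* **LEMMA (De-vs-De-Om) FOR `ℓ = 1`, PROVED** (`De_vs_De_Om_one`): if `v` satisfies the Neumann boundary relations then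
  `((−Δ_Ω + Q*Q) v_Ω)(x) = ((−Δ + Q*Q) v)(x)` for all `x ∈ Ω` («clearly holds for `ℓ = 1` by definition of `D_Ω`»).
* **LEMMA (De-vs-De-Om) FOR `ℓ = 2`, REFUTED AS PRINTED** (`De_vs_De_Om_two_fails`): `d = 2`, `L = n = 3` (one block), the finitely
  supported `v = δ_{(0,0)} + δ_{(−1,0)} + δ_{(0,−1)}` satisfies all four boundary relations (`neumannBC_v3`), yet at `x = (2,0)`,
  `((−Δ_Ω + Q*Q)² v_Ω)(x) − ((−Δ + Q*Q)² v)(x) = −1/9` (`defect_v3`).  The printed proof's step «if `f ∈ D_Ω` then also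
  `(−Δ + Q*Q)v ∈ D_Ω`» is what fails: `D_Ω` constrains boundary VALUES, while `(−Δ + Q*Q)v` on the boundary sees `v` two steps
  outside `Ω` (here `((−Δ+Q*Q)v)(3,0) = 0 ≠ 1/9 = ((−Δ+Q*Q)v)(2,0)`).  What the method of images actually uses — and what holds — is
  the identity for IMAGE-SYMMETRIC `v` (`v ∘ e = v` for the whole reflection group), which is the content of
  `DST24MethodOfImages.MΩ` being the descended kernel; the two method-of-images identities are theorems there
  (`method_of_images`, `coarse_method_of_images`), independently of Lemma (De-vs-De-Om).
* (v1.1) **LEMMA (De-vs-De-Om) IN ITS VALID FORM, ALL `ℓ`, PROVED** (`De_vs_De_Om_symmetric`): for `w : Ω → ℝ` and its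
  image-symmetric extension `v = w ∘ fold` (invariant under the whole reflection group; not in `𝓛²`),
  `((−Δ + Q*Q)^ℓ v)(x) = ((−Δ_Ω + Q*Q)^ℓ w)(x)` for all `x ∈ Ω`, `ℓ ∈ ℕ` — `M` preserves image symmetry (`applyZ_pullback`, from
  `MK_symMap`, `fold_symMap`), which is the printed step «then also `(−Δ + Q*Q)v ∈ D_Ω`» in the form in which it holds.
* (v1.1) **REMARK 4.1 IN ITS VALID FORM** (`green_Ω_pullback`): `Σ_{z∈Ω} G(Ω)(x,z)w(z) = Σ_{z̃∈ℤ^d} G(x,z̃)w(fold z̃)` — «`G(Ω)v_Ω = Gv`»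
  for image-symmetric `v = w ∘ fold` (by `green_Ω_eq_image_sum` and fibrewise summation).
* (v1.1) **LEMMA (projection-lemma-2d)** (`projection_lemma`): `v ∈ D_Ω ⇔ (P_μ v)(x) = v(x)` on `∂Ω_μ` and `(P̄_μ v)(x) = v(x)` on
  `∂Ω^μ`, with `P_μ x = x − e_μ` on `∂Ω_μ` (`reflAt_zero_of_face`) and `P̄_μ x = x + e_μ` on `∂Ω^μ` (`reflAt_one_of_face`).
-/

namespace Literature.MathematicalPhysics.QuantumFieldTheory.DybalskiStottmeisterTanimoto2024.DST24NeumannBoundary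

open Literature.MathematicalPhysics.QuantumFieldTheory.BalabanJaffe1986.BJ86DecayOfCorrelations
open Literature.MathematicalPhysics.QuantumFieldTheory.BalabanJaffe1986.BJ86KernelPeriodization
open Literature.MathematicalPhysics.QuantumFieldTheory.DybalskiStottmeisterTanimoto2024.DST24GreenDecayLattice
open Literature.MathematicalPhysics.QuantumFieldTheory.DybalskiStottmeisterTanimoto2024.DST24MethodOfImages
open scoped BigOperators

noncomputable section

variable {d : ℕ}

/-! ## §1 The row action of `M = −Δ + Q*Q` on an arbitrary function (finite sums: `M` has finite range) -/

/-- The finite set carrying the row `M(x, ·)`: `x`, `x ± e_μ`, and the block of `x`. [cite: DybalskiStottmeisterTanimoto2024, §4.3 Lemma (Green-function), proof («M := −Δ + Q*Q»)] -/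
def rowSupp (L : ℕ) (x : Fin d → ℤ) : Finset (Fin d → ℤ) :=
  insert x ((Finset.univ.image fun μ => x + e μ) ∪ (Finset.univ.image fun μ => x - e μ) ∪ boxZ L (blkZ L x))

/-- `x` is in its row support. [cite: DybalskiStottmeisterTanimoto2024, §4.3 Lemma (Green-function), proof] -/
theorem mem_rowSupp_self (L : ℕ) (x : Fin d → ℤ) : x ∈ rowSupp L x := Finset.mem_insert_self _ _

/-- `x + e_μ` is in the row support of `x`. [cite: DybalskiStottmeisterTanimoto2024, §4.3 Lemma (Green-function), proof] -/
theorem add_e_mem_rowSupp (L : ℕ) (x : Fin d → ℤ) (μ : Fin d) : x + e μ ∈ rowSupp L x :=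
  Finset.mem_insert_of_mem (Finset.mem_union_left _ (Finset.mem_union_left _ (Finset.mem_image.mpr ⟨μ, Finset.mem_univ _, rfl⟩)))

/-- `x − e_μ` is in the row support of `x`. [cite: DybalskiStottmeisterTanimoto2024, §4.3 Lemma (Green-function), proof] -/
theorem sub_e_mem_rowSupp (L : ℕ) (x : Fin d → ℤ) (μ : Fin d) : x - e μ ∈ rowSupp L x :=
  Finset.mem_insert_of_mem (Finset.mem_union_left _ (Finset.mem_union_right _ (Finset.mem_image.mpr ⟨μ, Finset.mem_univ _, rfl⟩)))

/-- The block of `x` is in the row support of `x`. [cite: DybalskiStottmeisterTanimoto2024, §4.3 Lemma (Green-function), proof] -/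
theorem boxZ_subset_rowSupp (L : ℕ) (x : Fin d → ℤ) : boxZ L (blkZ L x) ⊆ rowSupp L x := fun _ hy =>
  Finset.mem_insert_of_mem (Finset.mem_union_right _ hy)

/-- `M(x,y) = 0` off the row support. [cite: DybalskiStottmeisterTanimoto2024, §4.3 Lemma (Green-function), proof («M(x,x′) = 0 for |x−x′| > √2 L»)] -/
theorem MK_eq_zero_of_not_mem {L : ℕ} (hL : 0 < L) {x y : Fin d → ℤ} (hy : y ∉ rowSupp L x) : MK d L x y = 0 := by
  unfold rowSupp at hy
  simp only [Finset.mem_insert, Finset.mem_union, Finset.mem_image, Finset.mem_univ, true_and, not_or, not_exists] at hy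
  obtain ⟨h0, ⟨hp, hm⟩, hb⟩ := hy
  unfold MK lapK qqK
  rw [if_neg h0, if_neg (fun h => hb ((mem_boxZ hL).mpr h)), zero_sub, add_zero, neg_eq_zero]
  exact Finset.sum_eq_zero fun μ _ => by rw [if_neg (fun h => hp μ h.symm), if_neg (fun h => hm μ h.symm), add_zero]

/-- **The row action of `M = −Δ + Q*Q`**: `(Mw)(x) = 2d·w(x) − Σ_μ (w(x+e_μ) + w(x−e_μ)) + L^{−d} Σ_{y ∈ B(y_x)} w(y)` for every
`w : ℤ^d → ℝ`. [cite: DybalskiStottmeisterTanimoto2024, §3.3 (Green) («−Δ + Q*Q»), §1.1 (Q-def)] -/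
theorem tsum_MK_mul {L : ℕ} (hL : 0 < L) (x : Fin d → ℤ) (w : (Fin d → ℤ) → ℝ) :
    ∑' y, MK d L x y * w y =
      2 * (d : ℝ) * w x - ∑ μ : Fin d, (w (x + e μ) + w (x - e μ)) + ((L : ℝ) ^ d)⁻¹ * ∑ y ∈ boxZ L (blkZ L x), w y := by
  classical
  rw [tsum_eq_sum (s := rowSupp L x) (fun y hy => by rw [MK_eq_zero_of_not_mem hL hy, zero_mul])]
  have h1 : ∑ y ∈ rowSupp L x, (if y = x then 2 * (d : ℝ) else 0) * w y = 2 * (d : ℝ) * w x := by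
    simp_rw [ite_mul, zero_mul]
    rw [Finset.sum_ite_eq' (rowSupp L x) x, if_pos (mem_rowSupp_self L x)]
  have h2 : ∀ μ : Fin d, ∑ y ∈ rowSupp L x, ((if y = x + e μ then (1 : ℝ) else 0) + (if y = x - e μ then 1 else 0)) * w y =
      w (x + e μ) + w (x - e μ) := fun μ => by
    simp_rw [add_mul, ite_mul, one_mul, zero_mul]
    rw [Finset.sum_add_distrib, Finset.sum_ite_eq' (rowSupp L x), Finset.sum_ite_eq' (rowSupp L x),
      if_pos (add_e_mem_rowSupp L x μ), if_pos (sub_e_mem_rowSupp L x μ)]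
  have h3 : ∑ y ∈ rowSupp L x, (if blkZ L y = blkZ L x then ((L : ℝ) ^ d)⁻¹ else 0) * w y =
      ((L : ℝ) ^ d)⁻¹ * ∑ y ∈ boxZ L (blkZ L x), w y := by
    rw [Finset.mul_sum]
    symm
    refine (Finset.sum_congr rfl fun y hy => ?_).trans (Finset.sum_subset (boxZ_subset_rowSupp L x) fun y _ hy => ?_)
    · rw [if_pos ((mem_boxZ hL).mp hy)]
    · rw [if_neg (fun h => hy ((mem_boxZ hL).mpr h)), zero_mul]
  have step : ∀ y, MK d L x y * w y = (if y = x then 2 * (d : ℝ) else 0) * w y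
      - (∑ μ : Fin d, ((if y = x + e μ then (1 : ℝ) else 0) + (if y = x - e μ then 1 else 0)) * w y)
      + (if blkZ L y = blkZ L x then ((L : ℝ) ^ d)⁻¹ else 0) * w y := by
    intro y; unfold MK lapK qqK; rw [add_mul, sub_mul, Finset.sum_mul]
  rw [Finset.sum_congr rfl fun y _ => step y, Finset.sum_add_distrib, Finset.sum_sub_distrib, h1, h3, Finset.sum_comm,
    Finset.sum_congr rfl fun μ _ => h2 μ]

/-! ## §2 The action of `−Δ_Ω + Q*Q` and the boundary defect -/

/-- `lift(x + e_μ) = lift x + e_μ` inside `Ω`. [cite: DybalskiStottmeisterTanimoto2024, §4.4 Definition (Neumann)] -/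
theorem lift_update_succ {n : ℕ} (x : Fin d → Fin n) (μ : Fin d) (h : (x μ : ℕ) + 1 < n) :
    lift (Function.update x μ ⟨(x μ : ℕ) + 1, h⟩) = lift x + e μ := by
  funext ν
  unfold lift
  by_cases hν : ν = μ
  · subst hν; rw [Function.update_self, Pi.add_apply, e_apply_self]; push_cast; rfl
  · rw [Function.update_of_ne hν, Pi.add_apply, e_apply_of_ne hν, add_zero]

/-- `lift(x − e_μ) = lift x − e_μ` inside `Ω`. [cite: DybalskiStottmeisterTanimoto2024, §4.4 Definition (Neumann)] -/
theorem lift_update_pred {n : ℕ} (x : Fin d → Fin n) (μ : Fin d) (h : 0 < (x μ : ℕ)) :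
    lift (Function.update x μ (⟨(x μ : ℕ) - 1, lt_of_le_of_lt (Nat.sub_le _ _) (x μ).isLt⟩ : Fin n)) = lift x - e μ := by
  funext ν
  unfold lift
  by_cases hν : ν = μ
  · subst hν; rw [Function.update_self, Pi.sub_apply, e_apply_self]; push_cast [h]; ring
  · rw [Function.update_of_ne hν, Pi.sub_apply, e_apply_of_ne hν, sub_zero]

/-- The folded upper neighbour, lifted: `lift(fold(x + e_μ)) = x + e_μ` if `x_μ + 1 < n`, else `x`.
[cite: DybalskiStottmeisterTanimoto2024, §4.4 Definition (Neumann)] -/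
theorem lift_fold_lift_add_e {n : ℕ} (hn : 0 < n) (x : Fin d → Fin n) (μ : Fin d) :
    lift (fold n hn (lift x + e μ)) = if (x μ : ℕ) + 1 < n then lift x + e μ else lift x := by
  rw [fold_lift_add_e hn x μ]
  by_cases h : (x μ : ℕ) + 1 < n
  · rw [dif_pos h, if_pos h, lift_update_succ x μ h]
  · rw [dif_neg h, if_neg h]

/-- The folded lower neighbour, lifted: `lift(fold(x − e_μ)) = x − e_μ` if `0 < x_μ`, else `x`.
[cite: DybalskiStottmeisterTanimoto2024, §4.4 Definition (Neumann)] -/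
theorem lift_fold_lift_sub_e {n : ℕ} (hn : 0 < n) (x : Fin d → Fin n) (μ : Fin d) :
    lift (fold n hn (lift x - e μ)) = if 0 < (x μ : ℕ) then lift x - e μ else lift x := by
  rw [fold_lift_sub_e hn x μ]
  by_cases h : 0 < (x μ : ℕ)
  · rw [if_pos h, if_pos h, lift_update_pred x μ h]
  · rw [if_neg h, if_neg h]

/-- **The action of `−Δ_Ω + Q*Q`** on `w|_Ω`: `2d·w(x) − Σ_μ (w(lift fold(x+e_μ)) + w(lift fold(x−e_μ))) + L^{−d} Σ_{y∈B(y_x)} w(y)`.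
[cite: DybalskiStottmeisterTanimoto2024, §4.4 Definition (Neumann), Lemma (De-vs-De-Om)] -/
theorem sum_MΩ_mul {L n₁ : ℕ} (hL : 1 ≤ L) (hn : 0 < L * n₁) (w : (Fin d → ℤ) → ℝ) (x : Fin d → Fin (L * n₁)) :
    ∑ y, MΩ d L (L * n₁) hn x y * w (lift y) =
      2 * (d : ℝ) * w (lift x)
        - ∑ μ : Fin d, (w (lift (fold (L * n₁) hn (lift x + e μ))) + w (lift (fold (L * n₁) hn (lift x - e μ))))
        + ((L : ℝ) ^ d)⁻¹ * ∑ y ∈ boxZ L (blkZ L (lift x)), w y := by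
  classical
  have hL0 : 0 < L := hL
  have hLn : L ∣ L * n₁ := dvd_mul_right L n₁
  have step : ∀ y : Fin d → Fin (L * n₁), MΩ d L (L * n₁) hn x y * w (lift y) =
      (if y = x then 2 * (d : ℝ) * w (lift y) else 0)
        - (∑ μ : Fin d, ((if fold (L * n₁) hn (lift x + e μ) = y then w (lift y) else 0)
            + (if fold (L * n₁) hn (lift x - e μ) = y then w (lift y) else 0)))
        + (if blkZ L (lift y) = blkZ L (lift x) then ((L : ℝ) ^ d)⁻¹ else 0) * w (lift y) := by
    intro y
    rw [MΩ_apply hL hn hLn x y, add_mul, sub_mul, ite_mul, zero_mul, Finset.sum_mul]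
    congr 2
    refine Finset.sum_congr rfl fun μ _ => ?_
    rw [add_mul, ite_mul, one_mul, zero_mul, ite_mul, one_mul, zero_mul]
  have hQ : ∑ y : Fin d → Fin (L * n₁), (if blkZ L (lift y) = blkZ L (lift x) then ((L : ℝ) ^ d)⁻¹ else 0) * w (lift y) =
      ((L : ℝ) ^ d)⁻¹ * ∑ y ∈ boxZ L (blkZ L (lift x)), w y := by
    have hb : ∑ y ∈ boxZ L (blkZ L (lift x)), w y = ∑ y ∈ boxΩ L (blkΩ L x), w (lift y) := by
      rw [← lift_blkΩ L x, sum_boxΩ_eq_sum_boxZ hL0 hn w (blkΩ L x)]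
    rw [hb, Finset.mul_sum]
    symm
    refine (Finset.sum_congr rfl fun y hy => ?_).trans (Finset.sum_subset (Finset.subset_univ _) fun y _ hy => ?_)
    · rw [if_pos (by rw [← lift_blkΩ, ← lift_blkΩ, mem_boxΩ.mp hy])]
    · rw [if_neg (fun h => hy (mem_boxΩ.mpr (lift_injective (by rw [lift_blkΩ, lift_blkΩ]; exact h)))), zero_mul]
  rw [Finset.sum_congr rfl fun y _ => step y, Finset.sum_add_distrib, Finset.sum_sub_distrib, Finset.sum_ite_eq' Finset.univ x,
    if_pos (Finset.mem_univ _), Finset.sum_comm, hQ]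
  congr 2
  refine Finset.sum_congr rfl fun μ _ => ?_
  rw [Finset.sum_add_distrib, Finset.sum_ite_eq, Finset.sum_ite_eq, if_pos (Finset.mem_univ _), if_pos (Finset.mem_univ _)]

/-- **The boundary defect**: for every `w : ℤ^d → ℝ` and `x ∈ Ω = [0,Ln₁)^d`,
`((−Δ_Ω + Q*Q) w_Ω)(x) − ((−Δ + Q*Q) w)(x) = Σ_μ ([x_μ = n−1](w(x+e_μ) − w(x)) + [x_μ = 0](w(x−e_μ) − w(x)))`: one term per
Neumann bond dropped at `x`. [cite: DybalskiStottmeisterTanimoto2024, §4.4 Definition (Neumann), Lemma (De-vs-De-Om), proof] -/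
theorem MΩ_sub_MK_apply {L n₁ : ℕ} (hL : 1 ≤ L) (hn : 0 < L * n₁) (w : (Fin d → ℤ) → ℝ) (x : Fin d → Fin (L * n₁)) :
    ∑ y, MΩ d L (L * n₁) hn x y * w (lift y) - ∑' y, MK d L (lift x) y * w y =
      ∑ μ : Fin d, ((if (x μ : ℕ) + 1 < L * n₁ then 0 else w (lift x + e μ) - w (lift x))
        + (if 0 < (x μ : ℕ) then 0 else w (lift x - e μ) - w (lift x))) := by
  have hL0 : 0 < L := hL
  rw [sum_MΩ_mul hL hn w x, tsum_MK_mul hL0 (lift x) w]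
  have : ∀ μ : Fin d, (w (lift (fold (L * n₁) hn (lift x + e μ))) + w (lift (fold (L * n₁) hn (lift x - e μ))))
      = (w (lift x + e μ) + w (lift x - e μ)) - ((if (x μ : ℕ) + 1 < L * n₁ then 0 else w (lift x + e μ) - w (lift x))
        + (if 0 < (x μ : ℕ) then 0 else w (lift x - e μ) - w (lift x))) := by
    intro μ
    rw [lift_fold_lift_add_e hn x μ, lift_fold_lift_sub_e hn x μ]
    split_ifs <;> ring
  rw [Finset.sum_congr rfl fun μ _ => this μ, Finset.sum_sub_distrib]
  ring

/-! ## §3 Definition (Neumann) and Lemma (De-vs-De-Om) for `ℓ = 1` -/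

/-- **Definition (Neumann)**: `v : ℤ^d → ℝ` satisfies Neumann boundary conditions on `Ω = [0,n)^d` if `(∂*_μ v)(x) = 0` for
`x ∈ ∂Ω_μ` (`x_μ = 0`: `v(x) = v(x − e_μ)`) and `(∂_μ v)(x) = 0` for `x ∈ ∂Ω^μ` (`x_μ = n − 1`: `v(x + e_μ) = v(x)`) — the printed
`D_Ω` without the (here irrelevant) `𝓛²` condition. [cite: DybalskiStottmeisterTanimoto2024, §4.4 Definition (Neumann)] -/
def NeumannBC (n : ℕ) (v : (Fin d → ℤ) → ℝ) : Prop :=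
  ∀ (x : Fin d → Fin n) (μ : Fin d),
    ((x μ : ℕ) = 0 → v (lift x - e μ) = v (lift x)) ∧ ((x μ : ℕ) + 1 = n → v (lift x + e μ) = v (lift x))

/-- **Lemma (De-vs-De-Om) for `ℓ = 1`, PROVED**: for `v` with Neumann boundary values on `Ω = [0,Ln₁)^d`,
`((−Δ_Ω + Q*Q) v_Ω)(x) = ((−Δ + Q*Q) v)(x)` for every `x ∈ Ω` («Property (Neumann-free) clearly holds for `ℓ = 1` by definition of
`D_Ω`»). [cite: DybalskiStottmeisterTanimoto2024, §4.4 Lemma (De-vs-De-Om) (`ℓ = 1`)] -/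
theorem De_vs_De_Om_one {L n₁ : ℕ} (hL : 1 ≤ L) (hn : 0 < L * n₁) {v : (Fin d → ℤ) → ℝ} (hv : NeumannBC (L * n₁) v)
    (x : Fin d → Fin (L * n₁)) : ∑ y, MΩ d L (L * n₁) hn x y * v (lift y) = ∑' y, MK d L (lift x) y * v y := by
  rw [← sub_eq_zero, MΩ_sub_MK_apply hL hn v x]
  refine Finset.sum_eq_zero fun μ _ => ?_
  have h1 : (if (x μ : ℕ) + 1 < L * n₁ then (0 : ℝ) else v (lift x + e μ) - v (lift x)) = 0 := by
    split_ifs with h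
    · rfl
    · rw [((hv x μ).2 (by have := (x μ).isLt; omega)), sub_self]
  have h2 : (if 0 < (x μ : ℕ) then (0 : ℝ) else v (lift x - e μ) - v (lift x)) = 0 := by
    split_ifs with h
    · rfl
    · rw [((hv x μ).1 (by omega)), sub_self]
  rw [h1, h2, add_zero]


/-! ## §4 Lemma (De-vs-De-Om) for `ℓ = 2` FAILS as printed: `d = 2`, `L = n = 3`, `v = δ_{(0,0)} + δ_{(−1,0)} + δ_{(0,−1)}` -/

section Example

/-- The test function `v = δ_{(0,0)} + δ_{(−1,0)} + δ_{(0,−1)}` on `ℤ²` (finitely supported, hence in `𝓛²(ℤ²)`).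
[cite: DybalskiStottmeisterTanimoto2024, §4.4 Definition (Neumann)] -/
def v3 (y : Fin 2 → ℤ) : ℝ := if (y 0 = 0 ∧ y 1 = 0) ∨ (y 0 = -1 ∧ y 1 = 0) ∨ (y 0 = 0 ∧ y 1 = -1) then 1 else 0

/-- `(−Δ + Q*Q) v` for the test function (`L = 3`). [cite: DybalskiStottmeisterTanimoto2024, §4.4 Lemma (De-vs-De-Om)] -/
def w3 (y : Fin 2 → ℤ) : ℝ := ∑' z, MK 2 3 y z * v3 z

/-- The point `(3,0)` (outside `Ω`, across the face `∂Ω⁰`). [cite: DybalskiStottmeisterTanimoto2024, §4.4 Lemma (De-vs-De-Om)] -/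
def pP : Fin 2 → ℤ := ![3, 0]
/-- The boundary point `(2,0) ∈ ∂Ω⁰ ∩ ∂Ω₁`. [cite: DybalskiStottmeisterTanimoto2024, §4.4 Lemma (De-vs-De-Om)] -/
def pQ : Fin 2 → ℤ := ![2, 0]
/-- The point `(2,−1)` (outside `Ω`, across the face `∂Ω₁`). [cite: DybalskiStottmeisterTanimoto2024, §4.4 Lemma (De-vs-De-Om)] -/
def pR : Fin 2 → ℤ := ![2, -1]

/-- `v` as a function of the two coordinates. [cite: DybalskiStottmeisterTanimoto2024, §4.4 Lemma (De-vs-De-Om)] -/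
theorem v3_eq (y : Fin 2 → ℤ) (p q : ℤ) (h0 : y 0 = p) (h1 : y 1 = q) :
    v3 y = if (p = 0 ∧ q = 0) ∨ (p = -1 ∧ q = 0) ∨ (p = 0 ∧ q = -1) then 1 else 0 := by
  unfold v3; rw [h0, h1]

/-- `v` satisfies all four Neumann boundary relations on `Ω = [0,3)²`. [cite: DybalskiStottmeisterTanimoto2024, §4.4 Definition (Neumann)] -/
theorem neumannBC_v3 : NeumannBC (d := 2) (3 * 1) v3 := by
  intro x μ
  have b0 : 0 ≤ lift x 0 ∧ lift x 0 < 3 := by unfold lift; constructor <;> [positivity; exact_mod_cast (x 0).isLt]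
  have b1 : 0 ≤ lift x 1 ∧ lift x 1 < 3 := by unfold lift; constructor <;> [positivity; exact_mod_cast (x 1).isLt]
  have h10 : ¬((1 : Fin 2) = 0) := by decide
  have h01 : ¬((0 : Fin 2) = 1) := by decide
  have hv := v3_eq (lift x) (lift x 0) (lift x 1) rfl rfl
  have key0 : ((x 0 : ℕ) = 0 → v3 (lift x - e 0) = v3 (lift x)) ∧ ((x 0 : ℕ) + 1 = 3 * 1 → v3 (lift x + e 0) = v3 (lift x)) := by
    refine ⟨fun h => ?_, fun h => ?_⟩ <;> rw [hv]
    · have h' : lift x 0 = 0 := by unfold lift; exact_mod_cast h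
      rw [v3_eq (lift x - e 0) (lift x 0 - 1) (lift x 1) (by rw [sub_e_apply, if_pos rfl]) (by rw [sub_e_apply, if_neg h10])]
      exact if_congr ⟨fun hc => by omega, fun hc => by omega⟩ rfl rfl
    · have h' : lift x 0 = 2 := by unfold lift; push_cast; omega
      rw [v3_eq (lift x + e 0) (lift x 0 + 1) (lift x 1) (by rw [add_e_apply, if_pos rfl]) (by rw [add_e_apply, if_neg h10])]
      exact if_congr ⟨fun hc => by omega, fun hc => by omega⟩ rfl rfl
  have key1 : ((x 1 : ℕ) = 0 → v3 (lift x - e 1) = v3 (lift x)) ∧ ((x 1 : ℕ) + 1 = 3 * 1 → v3 (lift x + e 1) = v3 (lift x)) := by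
    refine ⟨fun h => ?_, fun h => ?_⟩ <;> rw [hv]
    · have h' : lift x 1 = 0 := by unfold lift; exact_mod_cast h
      rw [v3_eq (lift x - e 1) (lift x 0) (lift x 1 - 1) (by rw [sub_e_apply, if_neg h01]) (by rw [sub_e_apply, if_pos rfl])]
      exact if_congr ⟨fun hc => by omega, fun hc => by omega⟩ rfl rfl
    · have h' : lift x 1 = 2 := by unfold lift; push_cast; omega
      rw [v3_eq (lift x + e 1) (lift x 0) (lift x 1 + 1) (by rw [add_e_apply, if_neg h01]) (by rw [add_e_apply, if_pos rfl])]
      exact if_congr ⟨fun hc => by omega, fun hc => by omega⟩ rfl rfl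
  fin_cases μ
  · exact key0
  · exact key1

/-- `y_{(3,0)} = (1,0)`. [cite: DybalskiStottmeisterTanimoto2024, §4.4 Lemma (De-vs-De-Om)] -/
theorem blkZ_pP : blkZ 3 pP = ![1, 0] := by funext μ; fin_cases μ <;> simp [blkZ, pP]
/-- `y_{(2,0)} = (0,0)`. [cite: DybalskiStottmeisterTanimoto2024, §4.4 Lemma (De-vs-De-Om)] -/
theorem blkZ_pQ : blkZ 3 pQ = ![0, 0] := by funext μ; fin_cases μ <;> simp [blkZ, pQ]
/-- `y_{(2,−1)} = (0,−1)`. [cite: DybalskiStottmeisterTanimoto2024, §4.4 Lemma (De-vs-De-Om)] -/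
theorem blkZ_pR : blkZ 3 pR = ![0, -1] := by funext μ; fin_cases μ <;> simp [blkZ, pR]

/-- The block `B((1,0)) = [3,6) × [0,3)` carries no mass of `v`. [cite: DybalskiStottmeisterTanimoto2024, §4.4 Lemma (De-vs-De-Om)] -/
theorem boxsum_P : ∑ z ∈ boxZ 3 (![1, 0] : Fin 2 → ℤ), v3 z = 0 := by
  refine Finset.sum_eq_zero fun z hz => ?_
  have h0 := coord_of_mem_boxZ hz 0
  simp only [Matrix.cons_val_zero] at h0
  push_cast at h0
  rw [v3, if_neg]
  omega

/-- The block `B((0,0)) = Ω` carries the mass `v(0,0) = 1`. [cite: DybalskiStottmeisterTanimoto2024, §4.4 Lemma (De-vs-De-Om)] -/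
theorem boxsum_Q : ∑ z ∈ boxZ 3 (![0, 0] : Fin 2 → ℤ), v3 z = 1 := by
  rw [Finset.sum_eq_single_of_mem (![0, 0] : Fin 2 → ℤ) (mem_boxZ_iff_coords.mpr (fun μ => by fin_cases μ <;> simp)) ?_]
  · simp [v3]
  · intro z hz hne
    have h0 := coord_of_mem_boxZ hz 0
    have h1 := coord_of_mem_boxZ hz 1
    simp only [Matrix.cons_val_zero, Matrix.cons_val_one] at h0 h1
    push_cast at h0 h1
    rw [v3, if_neg]
    rintro (⟨h2, h3⟩ | ⟨h2, h3⟩ | ⟨h2, h3⟩)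
    · exact hne (by funext μ; fin_cases μ <;> simp [h2, h3])
    · omega
    · omega

/-- The block `B((0,−1)) = [0,3) × [−3,0)` carries the mass `v(0,−1) = 1`. [cite: DybalskiStottmeisterTanimoto2024, §4.4 Lemma (De-vs-De-Om)] -/
theorem boxsum_R : ∑ z ∈ boxZ 3 (![0, -1] : Fin 2 → ℤ), v3 z = 1 := by
  rw [Finset.sum_eq_single_of_mem (![0, -1] : Fin 2 → ℤ) (mem_boxZ_iff_coords.mpr (fun μ => by fin_cases μ <;> simp)) ?_]
  · simp [v3]
  · intro z hz hne
    have h0 := coord_of_mem_boxZ hz 0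
    have h1 := coord_of_mem_boxZ hz 1
    simp only [Matrix.cons_val_zero, Matrix.cons_val_one] at h0 h1
    push_cast at h0 h1
    rw [v3, if_neg]
    rintro (⟨h2, h3⟩ | ⟨h2, h3⟩ | ⟨h2, h3⟩)
    · omega
    · omega
    · exact hne (by funext μ; fin_cases μ <;> simp [h2, h3])

/-- `((−Δ + Q*Q)v)(3,0) = 0`. [cite: DybalskiStottmeisterTanimoto2024, §4.4 Lemma (De-vs-De-Om)] -/
theorem w3_pP : w3 pP = 0 := by
  unfold w3
  rw [tsum_MK_mul (by norm_num) pP v3, Fin.sum_univ_two, blkZ_pP, boxsum_P]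
  have h1 : v3 pP = 0 := by simp [v3, pP]
  have h2 : v3 (pP + e 0) = 0 := by simp [v3, pP, e]
  have h3 : v3 (pP - e 0) = 0 := by simp [v3, pP, e]
  have h4 : v3 (pP + e 1) = 0 := by simp [v3, pP, e]
  have h5 : v3 (pP - e 1) = 0 := by simp [v3, pP, e]
  rw [h1, h2, h3, h4, h5]; ring

/-- `((−Δ + Q*Q)v)(2,0) = 1/9` (the only contribution is `Q*Q`: `(0,0) ∈ B(y_{(2,0)}) = Ω`). [cite: DybalskiStottmeisterTanimoto2024, §4.4 Lemma (De-vs-De-Om)] -/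
theorem w3_pQ : w3 pQ = 1 / 9 := by
  unfold w3
  rw [tsum_MK_mul (by norm_num) pQ v3, Fin.sum_univ_two, blkZ_pQ, boxsum_Q]
  have h1 : v3 pQ = 0 := by simp [v3, pQ]
  have h2 : v3 (pQ + e 0) = 0 := by simp [v3, pQ, e]
  have h3 : v3 (pQ - e 0) = 0 := by simp [v3, pQ, e]
  have h4 : v3 (pQ + e 1) = 0 := by simp [v3, pQ, e]
  have h5 : v3 (pQ - e 1) = 0 := by simp [v3, pQ, e]
  rw [h1, h2, h3, h4, h5]; norm_num

/-- `((−Δ + Q*Q)v)(2,−1) = 1/9` (`(0,−1) ∈ B(y_{(2,−1)})`). [cite: DybalskiStottmeisterTanimoto2024, §4.4 Lemma (De-vs-De-Om)] -/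
theorem w3_pR : w3 pR = 1 / 9 := by
  unfold w3
  rw [tsum_MK_mul (by norm_num) pR v3, Fin.sum_univ_two, blkZ_pR, boxsum_R]
  have h1 : v3 pR = 0 := by simp [v3, pR]
  have h2 : v3 (pR + e 0) = 0 := by simp [v3, pR, e]
  have h3 : v3 (pR - e 0) = 0 := by simp [v3, pR, e]
  have h4 : v3 (pR + e 1) = 0 := by simp [v3, pR, e]
  have h5 : v3 (pR - e 1) = 0 := by simp [v3, pR, e]
  rw [h1, h2, h3, h4, h5]; norm_num

/-- The boundary point `x₀ = (2,0)` of `Ω = [0,3)²`. [cite: DybalskiStottmeisterTanimoto2024, §4.4 Lemma (De-vs-De-Om)] -/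
def x₀ : Fin 2 → Fin (3 * 1) := ![2, 0]

/-- `lift x₀ = (2,0)`. [cite: DybalskiStottmeisterTanimoto2024, §4.4 Lemma (De-vs-De-Om)] -/
theorem lift_x₀ : lift x₀ = pQ := by funext μ; fin_cases μ <;> rfl
/-- `(2,0) + e₀ = (3,0)`. [cite: DybalskiStottmeisterTanimoto2024, §4.4 Lemma (De-vs-De-Om)] -/
theorem pQ_add_e : pQ + e 0 = pP := by funext μ; fin_cases μ <;> simp [pQ, pP, e]
/-- `(2,0) − e₁ = (2,−1)`. [cite: DybalskiStottmeisterTanimoto2024, §4.4 Lemma (De-vs-De-Om)] -/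
theorem pQ_sub_e : pQ - e 1 = pR := by funext μ; fin_cases μ <;> simp [pQ, pR, e]

/-- **The defect at `x₀ = (2,0)`**: `((−Δ_Ω + Q*Q)(Mv)_Ω)(x₀) − ((−Δ + Q*Q)(Mv))(x₀) = −1/9`, `M = −Δ + Q*Q`.
[cite: DybalskiStottmeisterTanimoto2024, §4.4 Lemma (De-vs-De-Om) (`ℓ = 2`)] -/
theorem defect_v3 (hn : 0 < 3 * 1) :
    (∑ y, MΩ 2 3 (3 * 1) hn x₀ y * w3 (lift y)) - ∑' y, MK 2 3 (lift x₀) y * w3 y = -1 / 9 := by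
  rw [MΩ_sub_MK_apply (by norm_num : 1 ≤ 3) hn w3 x₀, Fin.sum_univ_two, lift_x₀, pQ_add_e, pQ_sub_e, w3_pP, w3_pQ,
    w3_pR]
  have h0 : ((x₀ 0 : Fin (3 * 1)) : ℕ) = 2 := rfl
  have h1 : ((x₀ 1 : Fin (3 * 1)) : ℕ) = 0 := rfl
  simp only [h0, h1]
  norm_num

/-- **LEMMA (De-vs-De-Om) FOR `ℓ = 2`, REFUTED AS PRINTED**: there is a (finitely supported) `v : ℤ² → ℝ` satisfying the Neumann
boundary relations of Definition (Neumann) on `Ω = [0,3)²` (`L = n = 3`) and a point `x ∈ Ω` with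
`((−Δ_Ω + Q*Q)² v_Ω)(x) ≠ ((−Δ + Q*Q)² v)(x)`.  (The identity DOES hold for image-symmetric `v`, the case used by the method of
images — `DST24MethodOfImages`.) [cite: DybalskiStottmeisterTanimoto2024, §4.4 Lemma (De-vs-De-Om)] -/
theorem De_vs_De_Om_two_fails : ∃ (v : (Fin 2 → ℤ) → ℝ) (hn : 0 < 3 * 1) (x : Fin 2 → Fin (3 * 1)),
    NeumannBC (3 * 1) v ∧
      (∑ y, MΩ 2 3 (3 * 1) hn x y * ∑ z, MΩ 2 3 (3 * 1) hn y z * v (lift z)) ≠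
        ∑' y, MK 2 3 (lift x) y * ∑' z, MK 2 3 y z * v z := by
  refine ⟨v3, by norm_num, x₀, neumannBC_v3, ?_⟩
  change (∑ y, MΩ 2 3 (3 * 1) _ x₀ y * ∑ z, MΩ 2 3 (3 * 1) _ y z * v3 (lift z)) ≠ ∑' y, MK 2 3 (lift x₀) y * w3 y
  have hΩ : ∀ y : Fin 2 → Fin (3 * 1), ∑ z, MΩ 2 3 (3 * 1) (by norm_num) y z * v3 (lift z) = w3 (lift y) := fun y =>
    De_vs_De_Om_one (by norm_num : 1 ≤ 3) (by norm_num) neumannBC_v3 y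
  simp_rw [hΩ]
  intro h
  have := defect_v3 (by norm_num)
  rw [h, sub_self] at this
  norm_num at this

end Example

/-! ## §5 (v1.1) What DOES hold for every `ℓ`: Lemma (De-vs-De-Om) for IMAGE-SYMMETRIC functions `v = w ∘ fold` -/

/-- The action of `M = −Δ + Q*Q` on functions on `ℤ^d` (finite row sums). [cite: DybalskiStottmeisterTanimoto2024, §3.3 (Green), §4.4 Lemma (De-vs-De-Om)] -/
def applyZ (L : ℕ) (v : (Fin d → ℤ) → ℝ) (z : Fin d → ℤ) : ℝ := ∑' z', MK d L z z' * v z'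

/-- The action of `−Δ_Ω + Q*Q` (Neumann) on functions on `Ω = [0,n)^d`. [cite: DybalskiStottmeisterTanimoto2024, §4.4 Definition (Neumann), Lemma (De-vs-De-Om)] -/
def applyΩ (L : ℕ) {n : ℕ} (hn : 0 < n) (w : (Fin d → Fin n) → ℝ) (x : Fin d → Fin n) : ℝ := ∑ y, MΩ d L n hn x y * w y

/-- Rows of `M` against any function are summable (finite support). [cite: DybalskiStottmeisterTanimoto2024, §4.3 Lemma (Green-function), proof] -/
theorem summable_MK_row_mul {L : ℕ} (hL : 0 < L) (z : Fin d → ℤ) (v : (Fin d → ℤ) → ℝ) :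
    Summable fun z' => MK d L z z' * v z' :=
  summable_of_ne_finset_zero (s := rowSupp L z) fun z' hz' => by rw [MK_eq_zero_of_not_mem hL hz', zero_mul]

/-- `ℓ = 1`, symmetric form, at the points of `Ω`: `(M(w ∘ fold))(lift x) = ((−Δ_Ω + Q*Q)w)(x)` — `MΩ` is the descended kernel.
[cite: DybalskiStottmeisterTanimoto2024, §4.4 Lemma (De-vs-De-Om) (`ℓ = 1`)] -/
theorem applyZ_pullback_lift {L n : ℕ} (hL : 1 ≤ L) (hn : 0 < n) (hLn : L ∣ n) (w : (Fin d → Fin n) → ℝ)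
    (x : Fin d → Fin n) : applyZ L (fun z => w (fold n hn z)) (lift x) = applyΩ L hn w x := by
  have hL0 : 0 < L := hL
  have hLn2 : (L : ℤ) ∣ 2 * (n : ℤ) := by
    obtain ⟨m, hm⟩ := hLn; exact ⟨2 * m, by rw [hm]; push_cast; ring⟩
  unfold applyZ applyΩ MΩ
  rw [← tsum_fib_eq (fold n hn) (summable_MK_row_mul hL0 (lift x) fun z => w (fold n hn z)), tsum_fintype]
  refine Finset.sum_congr rfl fun y _ => ?_
  rw [descend_eq_tsum_lift hn (fun s k a b => MK_symMap hL0 hLn2 s k a b) x y, ← tsum_mul_right]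
  refine tsum_congr fun zt => ?_
  rw [zt.2]

/-- `M` PRESERVES IMAGE SYMMETRY and acts through `−Δ_Ω + Q*Q`: `(M(w ∘ fold))(z) = ((−Δ_Ω + Q*Q)w)(fold z)` for EVERY `z ∈ ℤ^d`
(by the invariance `MK_symMap` under the reflection group and `fold_symMap`). This is the step «if `f ∈ D_Ω` then also
`(−Δ + Q*Q)v ∈ D_Ω`» in its valid form. [cite: DybalskiStottmeisterTanimoto2024, §4.4 Lemma (De-vs-De-Om), proof; Lemma (Q-reflection)] -/
theorem applyZ_pullback {L n : ℕ} (hL : 1 ≤ L) (hn : 0 < n) (hLn : L ∣ n) (w : (Fin d → Fin n) → ℝ) (z : Fin d → ℤ) :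
    applyZ L (fun z' => w (fold n hn z')) z = applyΩ L hn w (fold n hn z) := by
  have hL0 : 0 < L := hL
  have hLn2 : (L : ℤ) ∣ 2 * (n : ℤ) := by
    obtain ⟨m, hm⟩ := hLn; exact ⟨2 * m, by rw [hm]; push_cast; ring⟩
  obtain ⟨s, k, hσ⟩ := exists_symMap_eq_lift_fold hn z
  rw [← applyZ_pullback_lift hL hn hLn w (fold n hn z), ← hσ]
  unfold applyZ
  rw [← (symMap n s k).tsum_eq fun z' => MK d L (symMap n s k z) z' * w (fold n hn z')]
  refine tsum_congr fun z' => ?_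
  rw [MK_symMap hL0 hLn2, fold_symMap]

/-- Iterating: `M^ℓ (w ∘ fold) = ((−Δ_Ω + Q*Q)^ℓ w) ∘ fold`. [cite: DybalskiStottmeisterTanimoto2024, §4.4 Lemma (De-vs-De-Om) («we can iterate the argument»)] -/
theorem iterate_applyZ_pullback {L n : ℕ} (hL : 1 ≤ L) (hn : 0 < n) (hLn : L ∣ n) (ℓ : ℕ) (w : (Fin d → Fin n) → ℝ) :
    (applyZ (d := d) L)^[ℓ] (fun z => w (fold n hn z)) = fun z => ((applyΩ L hn)^[ℓ] w) (fold n hn z) := by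
  induction ℓ generalizing w with
  | zero => rfl
  | succ ℓ ih =>
    rw [Function.iterate_succ_apply, Function.iterate_succ_apply,
      show applyZ L (fun z => w (fold n hn z)) = fun z => (applyΩ L hn w) (fold n hn z) from funext (applyZ_pullback hL hn hLn w)]
    exact ih (applyΩ L hn w)

/-- **LEMMA (De-vs-De-Om) IN THE FORM THE METHOD OF IMAGES USES — all `ℓ`, PROVED**: for `w : Ω → ℝ` and its image-symmetric
extension `v := w ∘ fold` to `ℤ^d` (invariant under all reflections `P_μ`, `P̄_μ`; NOT in `𝓛²`),
`((−Δ + Q*Q)^ℓ v)(x) = ((−Δ_Ω + Q*Q)^ℓ w)(x)` for every `x ∈ Ω` and every `ℓ ∈ ℕ`.  Contrast `De_vs_De_Om_two_fails`: boundary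
relations alone do not suffice for `ℓ = 2`. [cite: DybalskiStottmeisterTanimoto2024, §4.4 Lemma (De-vs-De-Om)] -/
theorem De_vs_De_Om_symmetric {L n : ℕ} (hL : 1 ≤ L) (hn : 0 < n) (hLn : L ∣ n) (ℓ : ℕ) (w : (Fin d → Fin n) → ℝ)
    (x : Fin d → Fin n) : ((applyZ (d := d) L)^[ℓ] (fun z => w (fold n hn z))) (lift x) = ((applyΩ L hn)^[ℓ] w) x := by
  rw [iterate_applyZ_pullback hL hn hLn ℓ w]
  simp only [fold_lift hn x]

/-! ## §6 (v1.1) Lemma (projection-lemma-2d): `D_Ω` via the reflections `P_μ`, `P̄_μ` -/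

/-- The reflection `P_μ` (`t ↦ −1 − t` in the `μ`-th coordinate; `k = 0`) resp. `P̄_μ` (`t ↦ 2n − 1 − t`; `k = 1`) as a group
element `symMap`. [cite: DybalskiStottmeisterTanimoto2024, §4.4 («reflections P_μ, P̄_μ»)] -/
def reflAt (n : ℕ) (μ : Fin d) (k : ℤ) : (Fin d → ℤ) ≃ (Fin d → ℤ) :=
  symMap n (fun ν => decide (ν = μ)) (fun ν => if ν = μ then k else 0)

/-- On the face `∂Ω_μ` (`x_μ = 0`): `P_μ x = x − e_μ`. [cite: DybalskiStottmeisterTanimoto2024, §4.4 Lemma (projection-lemma-2d)] -/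
theorem reflAt_zero_of_face {n : ℕ} (x : Fin d → Fin n) (μ : Fin d) (h : (x μ : ℕ) = 0) :
    reflAt n μ 0 (lift x) = lift x - e μ := by
  funext ν
  show sym1 n (decide (ν = μ)) (if ν = μ then 0 else 0) (lift x ν) = (lift x - e μ) ν
  rw [sub_e_apply]
  unfold sym1 lift
  by_cases hν : ν = μ
  · subst hν; simp only [decide_true, ↓reduceIte, h]; push_cast; ring
  · simp only [hν, decide_false, Bool.false_eq_true, ↓reduceIte]; ring

/-- On the face `∂Ω^μ` (`x_μ = n − 1`): `P̄_μ x = x + e_μ`. [cite: DybalskiStottmeisterTanimoto2024, §4.4 Lemma (projection-lemma-2d)] -/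
theorem reflAt_one_of_face {n : ℕ} (x : Fin d → Fin n) (μ : Fin d) (h : (x μ : ℕ) + 1 = n) :
    reflAt n μ 1 (lift x) = lift x + e μ := by
  funext ν
  show sym1 n (decide (ν = μ)) (if ν = μ then 1 else 0) (lift x ν) = (lift x + e μ) ν
  rw [add_e_apply]
  unfold sym1 lift
  by_cases hν : ν = μ
  · subst hν
    simp only [decide_true, ↓reduceIte]
    have : (n : ℤ) = (x ν : ℕ) + 1 := by exact_mod_cast h.symm
    rw [this]; ring
  · simp only [hν, decide_false, Bool.false_eq_true, ↓reduceIte]; ring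

/-- **Lemma (projection-lemma-2d)** («immediate»): `v ∈ D_Ω` iff `(P_μ v)(x) = v(x)` for `x ∈ ∂Ω_μ` and `(P̄_μ v)(x) = v(x)` for
`x ∈ ∂Ω^μ` (`(Pv)(x) := v(Px)`). [cite: DybalskiStottmeisterTanimoto2024, §4.4 Lemma (projection-lemma-2d)] -/
theorem projection_lemma {n : ℕ} (v : (Fin d → ℤ) → ℝ) :
    NeumannBC n v ↔ ∀ (x : Fin d → Fin n) (μ : Fin d),
      ((x μ : ℕ) = 0 → v (reflAt n μ 0 (lift x)) = v (lift x)) ∧ ((x μ : ℕ) + 1 = n → v (reflAt n μ 1 (lift x)) = v (lift x)) := by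
  unfold NeumannBC
  refine forall_congr' fun x => forall_congr' fun μ => ?_
  refine and_congr (imp_congr_right fun h => ?_) (imp_congr_right fun h => ?_)
  · rw [reflAt_zero_of_face x μ h]
  · rw [reflAt_one_of_face x μ h]

/-! ## §7 (v1.1) Remark 4.1 in its valid form: `(G(Ω) w)(x) = (G (w ∘ fold))(x)` for image-symmetric data -/

/-- **Remark 4.1 in the form the method of images uses**: for the Neumann Green function `G(Ω)` of `−Δ_Ω + Q*Q` and the
infinite-lattice Green function `G` of `M = −Δ + Q*Q`, `Σ_{z∈Ω} G(Ω)(x,z) w(z) = Σ_{z̃∈ℤ^d} G(x,z̃) w(fold z̃)` for every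
`w : Ω → ℝ` and `x ∈ Ω` («`(G(Ω)v_Ω)(x) = (Gv)(x)`» for the image-symmetric `v = w ∘ fold`; absolutely convergent since the rows of
`G` are `ℓ¹`). [cite: DybalskiStottmeisterTanimoto2024, §4.4 Remark 4.1, Lemma (method-of-images-lemma-zero)] -/
theorem green_Ω_pullback {L n : ℕ} (hd : 1 ≤ d) (hL : 1 ≤ L) (hn : 0 < n) (hLn : L ∣ n)
    {G : (Fin d → ℤ) → (Fin d → ℤ) → ℝ} (hG : IsInverseKernel (MK d L) G)
    {GΩ : (Fin d → Fin n) → (Fin d → Fin n) → ℝ} (hGΩ : IsInverseKernel (MΩ d L n hn) GΩ)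
    (w : (Fin d → Fin n) → ℝ) (x : Fin d → Fin n) :
    ∑ z, GΩ x z * w z = ∑' zt, G (lift x) zt * w (fold n hn zt) := by
  rw [inverseKernel_MΩ_unique hn hGΩ (method_of_images hd hL hn hLn hG)]
  obtain ⟨C, C₁, -, hC₁, hdec⟩ := green_function_lattice (L := L) hd hL
  obtain ⟨β, hrows⟩ := rows_of_exp_decay hC₁ (hdec G hG)
  set B : ℝ := ∑ z, |w z| with hB
  have hwB : ∀ zt, |w (fold n hn zt)| ≤ B := fun zt =>
    Finset.single_le_sum (f := fun z => |w z|) (fun z _ => abs_nonneg (w z)) (Finset.mem_univ (fold n hn zt))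
  have hs : Summable fun zt => G (lift x) zt * w (fold n hn zt) :=
    Summable.of_norm_bounded ((hrows (lift x)).1.mul_right B) fun zt => by
      rw [Real.norm_eq_abs, abs_mul]
      exact mul_le_mul_of_nonneg_left (hwB zt) (abs_nonneg _)
  rw [← tsum_fib_eq (fold n hn) hs, tsum_fintype]
  refine Finset.sum_congr rfl fun z _ => ?_
  unfold imageSum
  rw [← tsum_mul_right]
  exact tsum_congr fun zt => by rw [zt.2]

end

end Literature.MathematicalPhysics.QuantumFieldTheory.DybalskiStottmeisterTanimoto2024.DST24NeumannBoundary
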